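import Literature.NumberTheory.LFunctions.DeBruijnNewman
import Mathlib.Analysis.Analytic.Order
import HarnessLib

/-!
# Csordas–Smith–Varga: the zeros of `H_t` are simple for `t > Λ` (named fact)

Trunk T-ANT (`Literature/NumberTheory/LFunctions`). One named fact (D-0014) about de Bruijn's
family `H_t = Literature.deBruijnH t` (`DeBruijnNewman.lean`; Rodgers–Tao normalisation
`H_t(z) = ∫₀^∞ e^{tu²} Φ(u) cos(zu) du`), needed by the decomposition of `Literature.NumberTheory.LFunctions.rodgers_tao`
(`RodgersTao.lean`, `RodgersTaoEnergy.lean`): Rodgers–Tao 2020, §1.2, "Let `Λ < t ≤ 0`, then the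
zeroes of `H_t` are all real […]. It is a result of Csordas, Smith, and Varga [CSV] that the
zeroes are also distinct and avoid the origin." The result quoted is

> **Csordas–Smith–Varga 1994, Thm. 2.2** (as printed in Andrade–Chang–Miller 2014, Lemma 1.5):
> *If `H_{t₀}(x)` has a zero `x₀` of order at least `2`, then `t₀ ≤ Λ`.*

(`Λ = Literature.deBruijnNewmanConst`, the de Bruijn–Newman constant; "avoid the origin" is elementary
and already proved in the tree, `Literature.NumberTheory.LFunctions.deBruijnH_apply_zero_ne_zero`: `H_t(0) > 0`.)

## The rendering

* `Literature.NumberTheory.LFunctions.csordasSmithVarga_simple_zeros` states the contrapositive in the `sInf`-free style of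
  `Equivalents.lean` / `DeBruijnNewman.lean`: if `t₁ < t₀` and `H_{t₁}` has only real zeros, then
  no real zero of `H_{t₀}` is a zero of its derivative. Here "`∃ t₁ < t₀` with `H_{t₁}` having only
  real zeros" is equivalent to `Λ < t₀` once the defining set of `Λ = sInf {t | H_t has only real
  zeros}` is known to be nonempty (de Bruijn, `Literature.NumberTheory.LFunctions.hasOnlyRealZeros_deBruijnH_one_half`) and
  bounded below (Newman, `Literature.NumberTheory.LFunctions.bddBelow_setOf_hasOnlyRealZeros`) — both named facts of
  `DeBruijnNewman.lean`, both discharged in `DeBruijnNewmanConstProofs.lean`; the equivalence with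
  the printed form is `Literature.NumberTheory.LFunctions.csordasSmithVarga_simple_zeros_iff` below. "Zero of order at least 2"
  is rendered `H(x₀) = 0 ∧ H'(x₀) = 0`, which for the entire function `H_{t₀}`
  (`Literature.NumberTheory.LFunctions.differentiable_deBruijnH`) is `2 ≤ analyticOrderAt (H_{t₀}) x₀`
  (`Literature.NumberTheory.LFunctions.two_le_analyticOrderAt_deBruijnH_iff`). The zero `x₀` is taken real: under the hypothesis
  every zero of `H_{t₀}` is real (de Bruijn's monotonicity `Literature.NumberTheory.LFunctions.HasOnlyRealZeros.mono_deBruijnH`),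
  so nothing is lost, and this is how Rodgers–Tao use it.
* Consequence used by the Rodgers–Tao decomposition (`RodgersTaoZerosProofs.lean`): under
  `Λ < 0` (some `H_{t}`, `t < 0`, has only real zeros) every zero of `H_0 = ξ(½ + iz/2)/8` is
  simple, hence so is every non-trivial zero of `ζ`, and the ordinates `γ_n` are distinct
  (`Literature.NumberTheory.LFunctions.csordasSmithVarga_simple_zeros.deriv_deBruijnH_zero_ne_zero` below is the `t = 0` case).

## References

* G. Csordas, W. Smith, R. S. Varga, *Lehmer pairs of zeros, the de Bruijn–Newman constant `Λ`,
  and the Riemann Hypothesis*, Constr. Approx. 10 (1994), 107–129, Thm. 2.2.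
* J. Andrade, A. Chang, S. J. Miller, *Newman's conjecture in various settings*, J. Number
  Theory 144 (2014), 70–91 = arXiv:1310.3477, Lemma 1.5 (quoting CSV Thm. 2.2), Remark 1.6.
* B. Rodgers, T. Tao, *The de Bruijn–Newman constant is non-negative*, Forum Math. Pi 8 (2020),
  e6 = arXiv:1801.05914, §1.2.
-/

noncomputable section

open Complex Set

namespace Literature.NumberTheory.LFunctions

/-- NAMED FACT (**Csordas–Smith–Varga 1994, Thm. 2.2**; printed as Lemma 1.5 of
Andrade–Chang–Miller 2014: "If `H_{t₀}(x)` has a zero `x₀` of order at least `2`, then `t₀ ≤ Λ`";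
used by Rodgers–Tao 2020, §1.2: for `Λ < t ≤ 0` "the zeroes are also distinct"). `sInf`-free
contrapositive: if `t₁ < t₀` and `H_{t₁}` has only real zeros (i.e. `Λ ≤ t₁ < t₀`), then every
real zero `x₀` of `H_{t₀}` is simple, `H_{t₀}'(x₀) ≠ 0`. Equivalent to the printed form given
de Bruijn's `Λ ≤ 1/2` and Newman's `Λ > −∞` (`csordasSmithVarga_simple_zeros_iff`). Users take
`(h : csordasSmithVarga_simple_zeros)`. [cite: CsordasSmithVarga1994, Thm. 2.2]
[cite: AndradeChangMiller2014, Lemma 1.5] -/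
def csordasSmithVarga_simple_zeros : Prop :=
  ∀ t₁ t₀ : ℝ, t₁ < t₀ → HasOnlyRealZeros (deBruijnH t₁) →
    ∀ x : ℝ, deBruijnH t₀ x = 0 → deriv (deBruijnH t₀) x ≠ 0

/-- The `sInf`-free rendering agrees with the printed one, "a real zero of `H_{t₀}` of order at
least `2` forces `t₀ ≤ Λ`", as soon as `{t | H_t has only real zeros}` is nonempty (de Bruijn:
`hasOnlyRealZeros_deBruijnH_one_half`) and bounded below (Newman:
`bddBelow_setOf_hasOnlyRealZeros`), for then `Λ < t₀ ↔ ∃ t₁ < t₀, H_{t₁}` has only real zeros.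
[cite: AndradeChangMiller2014, Lemma 1.5] -/
theorem csordasSmithVarga_simple_zeros_iff (hne : hasOnlyRealZeros_deBruijnH_one_half)
    (hb : bddBelow_setOf_hasOnlyRealZeros) :
    csordasSmithVarga_simple_zeros ↔
      ∀ (t₀ : ℝ) (x : ℝ), deBruijnH t₀ x = 0 → deriv (deBruijnH t₀) x = 0 →
        t₀ ≤ deBruijnNewmanConst := by
  have hS : {t : ℝ | HasOnlyRealZeros (deBruijnH t)}.Nonempty := ⟨1 / 2, hne⟩
  constructor
  · intro h t₀ x hx hdx
    by_contra hlt
    push Not at hlt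
    obtain ⟨t₁, ht₁, ht₁lt⟩ := (csInf_lt_iff hb hS).1 hlt
    exact h t₁ t₀ ht₁lt ht₁ x hx hdx
  · intro h t₁ t₀ hlt ht₁ x hx hdx
    have h1 : deBruijnNewmanConst ≤ t₁ := csInf_le hb ht₁
    have h2 := h t₀ x hx hdx
    exact absurd (h1.trans_lt hlt) (not_lt.2 h2)

/-- "Zero of order at least `2`" for the entire function `H_t` (`differentiable_deBruijnH`,
discharged in `DeBruijnNewmanProofs.lean`) means `H_t(z) = 0 ∧ H_t'(z) = 0`. [folklore] -/
theorem two_le_analyticOrderAt_deBruijnH_iff (hd : differentiable_deBruijnH) (t : ℝ) (z : ℂ) :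
    (2 : ℕ∞) ≤ analyticOrderAt (deBruijnH t) z ↔ deBruijnH t z = 0 ∧ deriv (deBruijnH t) z = 0 := by
  have ha : AnalyticAt ℂ (deBruijnH t) z := (hd t).analyticAt z
  rw [show (2 : ℕ∞) = ((2 : ℕ) : ℕ∞) from rfl,
    natCast_le_analyticOrderAt_iff_iteratedDeriv_eq_zero ha]
  constructor
  · intro h
    exact ⟨by simpa using h 0 (by norm_num), by simpa using h 1 (by norm_num)⟩
  · rintro ⟨h0, h1⟩ i hi
    interval_cases i
    · simpa using h0
    · simpa using h1

/-- The case used by Rodgers–Tao 2020 (§1.2, §9): if some `H_t` with `t < 0` has only real zeros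
(`Λ < 0`), then every real zero of `H_0` is simple. [cite: RodgersTaoFMP2020, §1.2] -/
theorem csordasSmithVarga_simple_zeros.deriv_deBruijnH_zero_ne_zero
    (h : csordasSmithVarga_simple_zeros) (hΛ : ∃ t : ℝ, t < 0 ∧ HasOnlyRealZeros (deBruijnH t))
    {x : ℝ} (hx : deBruijnH 0 x = 0) : deriv (deBruijnH 0) x ≠ 0 := by
  obtain ⟨t, ht, hreal⟩ := hΛ
  exact h t 0 ht hreal x hx

end Literature.NumberTheory.LFunctions

end
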